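import Literature.IUT.HodgeArakelov.EtaleThetaDataOfSettingInversion
import Literature.AnabelianGeometry.EtaleTheta.Discharge.Sec1ThetaCompanionOfAut

/-!
# [IUTchII] Prop 2.2 (ii) at the MODEL: the inversion's theta companion SUPPLIED (GAP row G-w4d010-2, residual (R1b))

abc-iut cell (WAVE-5 seat abc-iut-w5-d072; cone of [IUTchIII] Cor. 3.12; DAG node **IUTchII:Prop2.2(ii)**; plan/GAP-LEDGER.md
row G-w4d010-2, disposition D-G-w4d010-2f, residual (R1b) «a theta companion of `ι`»). S. Mochizuki, *Inter-universal
Teichmüller theory II*, kurims manuscript (Dec. 2020) §2 Prop. 2.2 (ii) p. 66 (claim key `Mochizuki2012`, DISPUTED, D-0012);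
[EtTh] Thm. 1.6 (ii) p. 24 [cite: MochizukiEtTh2009, Thm 1.6 (ii) p.24].

PROOF-ONLY sequel (no definitions) of `EtaleThetaDataOfSettingInversion.lean` (p416287: `prop22_ii'_model_of_inversion` from
`(ι, hι, c : ThetaCompanion ι, hZ)` + (R2)(R3)) and of the L2-side CONSTRUCTION `ThetaSetting.thetaCompanionOfAut`
(`EtaleTheta/Discharge/Sec1ThetaCompanionOfAut.lean`: the theta companion of an automorphism `ι` of `Π^tp_X` with
`ι(Δ^tp_X) = Δ^tp_X`, when `toTheta` is a topological quotient map): the binder `c` is REPLACED by the two print-transparent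
inputs `hΔ : ι(Δ^tp_X) = Δ^tp_X` ([AbsAnab] Lem. 1.3.8 shape — automatic for an automorphism over `G_K`) and
`hq : IsQuotientMap toTheta` (the root `Setting.lean` records only `Continuous toTheta`). Versions: `prop22_ii'_model_of_inversion'`
(generic [EtTh] §1 setting) and `prop22_ii'_model_of_epsPM'` ([EtTh] Def. 1.7's `MuTwoSetting`, `ι := (ε_±-conjugation)|Π^tp_X`).
[claim: Mochizuki2012, status: disputed] Nothing here takes a side on [IUTchIII] Cor. 3.12; typed ≠ proved for the remaining
inputs (R1a) `hι`, (R1c) `hZ`, (R1d) `hind`, `hΔ`, `hq`, (R2), (R3).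
-/

namespace Literature.IUT.HodgeArakelov

open Literature.AnabelianGeometry.EtaleTheta (ContH1 ThetaSetting)
open EtaleThetaDataOfSetting CohomologySystemOfContH1 Topology

noncomputable section

namespace EtaleThetaDataOfSetting

variable {p : ℕ} [Fact p.Prime]

/-- **IUTchII:Prop2.2(ii)′ at the model, the theta companion of the inversion SUPPLIED** (kurims p. 66): as
`prop22_ii'_model_of_inversion`, with the binder `c : ThetaCompanion ι` replaced by `hΔ : ι(Δ^tp_X) = Δ^tp_X` and
`hq : IsQuotientMap toTheta` through abc-iut-w5-d072's `ThetaSetting.thetaCompanionOfAut ι hΔ hq` ([EtTh] Thm. 1.6 (ii),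
constructed). Remaining (R1) inputs: `hι` (`ι` stabilises `Π^tp_X̲̲`), `hΔ`, `hq`, `hZ` (`ℤ`-reversal at `γ`); plus (R2)(R3).
[claim: Mochizuki2012, status: disputed] (IUTchII §2 Prop 2.2 (ii), kurims pp.65-67) -/
theorem prop22_ii'_model_of_inversion' {D : Literature.AnabelianGeometry.EtaleTheta.ThetaSetting p}
    {E : D.EtaleThetaData} {l : ℕ} (C : E.DoubleUnderline l) [hN : (PiYdd C).Normal] (hC : D.Compat)
    (hS : D.Sec2Hyps) (hchar : PiYddCharacteristic C) (S : BadPlaceSetting.{0}) (eS : (Pi C) ≃ₜ* S.PiX) (hl : S.l = l)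
    {T : TemperedCoverings S (Pi C)}
    (Dec : SubgraphDecomposition S T (etaleThetaDataOfSetting' C hC hS hchar S.toThetaSetting eS hl))
    -- (R1) reduced: the inversion `ι` of `Π^tp_X`, stabilising `Π^tp_X̲̲` and `Δ^tp_X`, `toTheta` a quotient map, `ℤ`-reversal
    (ι : D.PiTemp ≃ₜ* D.PiTemp) (hι : C.Huu.map ι.toMulEquiv.toMonoidHom = C.Huu)
    (hΔ : D.DeltaTemp.map ι.toMulEquiv.toMonoidHom = D.DeltaTemp) (hq : IsQuotientMap D.toTheta)
    (γ ε : Pi C) (hγ : C.toLZ γ = Multiplicative.ofAdd 1) (hε₁ : (ε : D.PiTemp) ∈ D.GtpY)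
    (hε₂ : (ε : D.PiTemp) ∉ D.GtpYdd) (hZ : D.toZ (ι (γ : D.PiTemp)) = (D.toZ (γ : D.PiTemp))⁻¹)
    -- (R2) [EtTh] Prop. 1.4 (ii) at the class level
    (hsign : ∃ κ : ContH1 (phi C) (D.lDeltaTheta l) (PiYdd C ⊓ ⊤), κ ^ 2 = 1 ∧
      ContH1.conj (phi C) (D.lDeltaTheta l) ε (rootLiftClass C) = rootLiftClass C * κ)
    (hroot : ∃ τ₀ : Pi C, (τ₀ : D.PiTemp) ∈ D.GtpY ∧
      inversionTransport C ι hι (D.thetaCompanionOfAut ι hΔ hq) hchar (rootLiftClass C) =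
        ContH1.conj (phi C) (D.lDeltaTheta l) τ₀ (rootLiftClass C))
    -- (R3) [EtTh] Prop. 1.4 (i)/(iii) at the class level
    (hfree : ∀ m n : ℤ, IsOfFinAddOrder
      ((h1Top C).symm (Additive.ofMul (ContH1.conj (phi C) (D.lDeltaTheta l) (γ ^ m) (rootLiftClass C))) -
        (h1Top C).symm (Additive.ofMul (ContH1.conj (phi C) (D.lDeltaTheta l) (γ ^ n) (rootLiftClass C)))) →
      m = n) :
    Prop22_ii' Dec :=
  prop22_ii'_model_of_inversion C ι hι (D.thetaCompanionOfAut ι hΔ hq) hC hS hchar S eS hl Dec γ ε hγ hε₁ hε₂ hZ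
    hsign hroot hfree

/-- **IUTchII:Prop2.2(ii)′ at the model over [EtTh] Def. 1.7's setting, `ι := (ε_±-conjugation)|Π^tp_X`, companion SUPPLIED**
(kurims p. 66): as `prop22_ii'_model_of_epsPM`, with `c` replaced by `hΔ : ε_±` normalises `Δ^tp_X` (as a subgroup of `Π^tp_X`
through `inclX`; print: `Δ^tp_X = Π^tp_X ∩ Δ^tp_C`) and `hq`. Remaining (R1) inputs at Def. 1.7's setting: `hind`, `hι`, `hΔ`,
`hq`, `hZ`; plus (R2)(R3). [claim: Mochizuki2012, status: disputed] (IUTchII §2 Prop 2.2 (ii), kurims pp.65-67) -/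
theorem prop22_ii'_model_of_epsPM' (M : Literature.AnabelianGeometry.EtaleTheta.MuTwoSetting p)
    (hind : Topology.IsInducing M.inclX) {E : M.toThetaSetting.EtaleThetaData} {l : ℕ} (C : E.DoubleUnderline l)
    [hN : (PiYdd C).Normal] (hC : M.toThetaSetting.Compat) (hS : M.toThetaSetting.Sec2Hyps)
    (hchar : PiYddCharacteristic C) (S : BadPlaceSetting.{0}) (eS : (Pi C) ≃ₜ* S.PiX) (hl : S.l = l)
    {T : TemperedCoverings S (Pi C)}
    (Dec : SubgraphDecomposition S T (etaleThetaDataOfSetting' C hC hS hchar S.toThetaSetting eS hl))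
    -- (R1) at Def. 1.7's setting
    (hι : C.Huu.map (epsPMInversion M hind).toMulEquiv.toMonoidHom = C.Huu)
    (hΔ : M.toThetaSetting.DeltaTemp.map (epsPMInversion M hind).toMulEquiv.toMonoidHom = M.toThetaSetting.DeltaTemp)
    (hq : IsQuotientMap M.toTheta)
    (γ ε : Pi C) (hγ : C.toLZ γ = Multiplicative.ofAdd 1) (hε₁ : (ε : M.PiTemp) ∈ M.toThetaSetting.GtpY)
    (hε₂ : (ε : M.PiTemp) ∉ M.toThetaSetting.GtpYdd)
    (hZ : M.toZ (epsPMInversion M hind (γ : M.PiTemp)) = (M.toZ (γ : M.PiTemp))⁻¹)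
    -- (R2) [EtTh] Prop. 1.4 (ii) at the class level
    (hsign : ∃ κ : ContH1 (phi C) (M.toThetaSetting.lDeltaTheta l) (PiYdd C ⊓ ⊤), κ ^ 2 = 1 ∧
      ContH1.conj (phi C) (M.toThetaSetting.lDeltaTheta l) ε (rootLiftClass C) = rootLiftClass C * κ)
    (hroot : ∃ τ₀ : Pi C, (τ₀ : M.PiTemp) ∈ M.toThetaSetting.GtpY ∧
      inversionTransport C (epsPMInversion M hind) hι
          (M.toThetaSetting.thetaCompanionOfAut (epsPMInversion M hind) hΔ hq) hchar (rootLiftClass C) =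
        ContH1.conj (phi C) (M.toThetaSetting.lDeltaTheta l) τ₀ (rootLiftClass C))
    -- (R3) [EtTh] Prop. 1.4 (i)/(iii) at the class level
    (hfree : ∀ m n : ℤ, IsOfFinAddOrder
      ((h1Top C).symm (Additive.ofMul
          (ContH1.conj (phi C) (M.toThetaSetting.lDeltaTheta l) (γ ^ m) (rootLiftClass C))) -
        (h1Top C).symm (Additive.ofMul
          (ContH1.conj (phi C) (M.toThetaSetting.lDeltaTheta l) (γ ^ n) (rootLiftClass C)))) →
      m = n) :
    Prop22_ii' Dec :=
  prop22_ii'_model_of_inversion' C hC hS hchar S eS hl Dec (epsPMInversion M hind) hι hΔ hq γ ε hγ hε₁ hε₂ hZ hsign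
    hroot hfree

end EtaleThetaDataOfSetting

end

end Literature.IUT.HodgeArakelov
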